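import Literature.AlgebraicGeometry.Motives.AlbaneseByMaximality
import Literature.AlgebraicGeometry.Motives.AbelianVarietyRationalCurvesProofs
import Literature.AlgebraicGeometry.Motives.AbelianVarietyDimZeroProofs
import Mathlib.AlgebraicGeometry.SpreadingOut
import HarnessLib

/-!
# Morphisms to abelian varieties from schemes whose function field embeds in `K(t)` are constant
# (Milne, *Abelian Varieties*, §3 Cor. 3.8, birational form; trivial Jacobians)

Topic `Literature/AlgebraicGeometry/Motives`, namespace `Literature.AlgebraicGeometry.Motives`;
THEOREMS ONLY (no definition, no named fact, no instance, sorry-free; D-0026).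

Milne, *Abelian Varieties*, §3 Cor. 3.8 ("every rational map `ℙ¹ → A` is constant": abelian varieties
contain no rational curves) is ★ `Milne1986_projectiveLine_to_abelianVariety_const_holds` ∕
★ `AbelianVariety.specMap_affineLine_const` (`Motives/AbelianVarietyRationalCurvesProofs`). This file proves the
BIRATIONAL form — the one needed for curves of genus `0`, whose function field is `K(t)` (Stichtenoth Prop. 1.6.3,
★ `AlgFunctionField.nonempty_algEquiv_ratFunc_of_genus_eq_zero`) but which are not given as `ℙ¹`:

* **`exists_isDominant_of_functionField_algHom`** — a `K`-algebra homomorphism of function fields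
  `K(C) → K(X)` (`C` locally of finite type, `X` integral) comes from a DOMINANT `K`-morphism `U → C` on a
  non-empty open `U ⊆ X` (Hartshorne I Thm. 4.4: dominant rational maps versus function-field embeddings):
  the `K`-morphism `Spec K(X) → Spec K(C) → C` spreads out from the generic stalk of `X` (Mathlib
  `spread_out_of_isGermInjective'`, Stacks 0BX6) and the spread hits the generic point of `C`.
* **`AbelianVariety.exists_eq_hom_comp_of_isDominant`** — a reduced (here: integral) `K`-scheme `C` DOMINATED
  by an open `U` of the affine line `𝔸¹_K = Spec K[X₀]` admits only constant `K`-morphisms `ψ : C → A` to abelian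
  varieties, `ψ = (C → Spec K) ≫ P₀` for a section `P₀`: `U → C → A` extends to `𝔸¹ → A` (Milne AV Thm. 3.1,
  ★ `AbelianVariety.exists_extension_specMap`), which is constant (Cor. 3.8, ★ `AbelianVariety.specMap_affineLine_const`),
  so `ψ` agrees with a constant map after the dominant `U → C`, and `A` is separated (Mathlib
  `ext_of_isDominant_of_isSeparated`).
* **`AbelianVariety.exists_eq_hom_comp_of_functionField_toRatFunc`** (+ `…_toSpecOver_comp…`, `hom_base_eq_…`,
  `eq_one_of_point_comp_eq_one_…`) — hence an integral `K`-scheme `C`, locally of finite type, whose function field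
  EMBEDS over `K` into the rational function field `K(t)` ("unirational curves") admits only constant morphisms to
  abelian varieties.  The embedding `K(t) → K(𝔸¹)` over `K` is built inside the proof from the germ of `X₀` at the
  generic point (compatibility of the tree's `K`-algebra structure `RatFn.algebraStalk` with `K → K[X₀]`,
  Mathlib `Scheme.ΓSpecIso_inv_naturality`).
* **`Jacobian.nonempty_of_functionField_toRatFunc`**, **`Jacobian.dim_eq_zero_of_functionField_toRatFunc`** — if
  moreover `C` is proper, geometrically integral, with a `K`-point, then the trivial abelian variety `0 = Spec K`
  (★ `AbelianVariety.trivial`) with the constant map is a Jacobian of `C` (Milne, *Jacobian Varieties*, Prop. 6.1 ⇒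
  Prop. 6.4, ★ `Jacobian.ofPointed`), and EVERY Jacobian of `C` has dimension `0` (the Abel–Jacobi map `f^P` is
  pointed hence trivial, and its image generates `J`, ★ `Jacobian.hom_ext_abelJacobi`; `𝟙_J = 0` forces `dim J = 0`,
  ★ `AbelianVariety.not_isIsogeny_zero_of_dim_pos`).

The genus-`0` corollaries over an algebraically closed field (Milne JV Thm. 1.1 ∕ Prop. 2.1 in genus `0`, closing the
`-- TODO(general form): genus 0` of ★ `Motives/WeilJacobianUniversal`) are one application of
★ `nonempty_algEquiv_ratFunc_of_genus_eq_zero` away and are left to a sequel importing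
`Literature.NumberTheory.DiophantineGeometry.BelyiDegreeGenusZero`.
-- TODO(general form): Milne AV Cor. 3.8 for rational maps from any unirational VARIETY (function field inside a
-- purely transcendental extension `K(t₁, …, tₙ)`): the same proof with `𝔸ⁿ` (★ `smooth_specOver_mvPolynomial n`)
-- once constancy of `𝔸ⁿ → A` is recorded for `n ≥ 2`.

Cell `hodgecm-mathlib` (D-0151), count-neutral capital of the (W1) Weil–Jacobian lineage. HC_CM is proved only
modulo the 7 printed citations until rung 0 closes; this file discharges none of them.

## References

* J. S. Milne, *Abelian Varieties*, in G. Cornell, J. H. Silverman (eds.), *Arithmetic Geometry* (Storrs 1984),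
  Springer 1986, Ch. V, §3 Thm. 3.1 and Cor. 3.8 (p. 107). [Milne1986AbelianVarieties]
* J. S. Milne, *Jacobian Varieties*, ibid., Ch. VII, Prop. 2.1, §6 Prop. 6.1 and Prop. 6.4. [Milne1986JacobianVarieties]
* R. Hartshorne, *Algebraic Geometry*, GTM 52 (1977), I Thm. 4.4 (p. 25), II Ex. 4.2. [Hartshorne1977]
* The Stacks Project, Tag 0BX6 (spreading out a morphism from a local ring). [StacksProject]
-/

set_option autoImplicit false

noncomputable section

universe u

open CategoryTheory CategoryTheory.Limits AlgebraicGeometry MonoidalCategory CartesianMonoidalCategory MonObj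

namespace Literature.AlgebraicGeometry.Motives

open AbelianVarietyRationalCurves

/-! ### A `K`-embedding of function fields `K(C) ↪ K(X)` yields a dominant `K`-morphism from an open of `X` -/

section RationalMap

variable {K : Type u} [Field K] (C X : SchemeOver K) [IsIntegral C.left] [LocallyOfFiniteType C.hom]
  [IsIntegral X.left]

/-- **A `K`-algebra homomorphism of function fields `K(C) → K(X)` is induced by a dominant `K`-morphism
`U → C` from a non-empty open `U ⊆ X`** (`C` locally of finite type, `X` integral): the `K`-morphism
`Spec K(X) → Spec K(C) → C` spreads out from the generic stalk of `X` to an open neighbourhood of the generic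
point (Mathlib `spread_out_of_isGermInjective'`), and the spread hits the generic point of `C` (Hartshorne I.4.4
∕ II Ex. 3.?: dominant rational maps versus function-field embeddings). [cite: StacksProject, Tag 0BX6] [cite: Hartshorne1977, I Thm. 4.4 (p. 25)] -/
theorem exists_isDominant_of_functionField_algHom (χ : C.left.functionField →ₐ[K] X.left.functionField) :
    ∃ (U : X.left.Opens) (f : (U : Scheme.{u}) ⟶ C.left),
      Nonempty (U : Scheme.{u}) ∧ IsDominant f ∧ f ≫ C.hom = U.ι ≫ X.hom := by
  have hφ : (Spec.map (CommRingCat.ofHom (χ : C.left.functionField →+* X.left.functionField)) ≫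
      C.left.fromSpecStalk (genericPoint C.left)) ≫ C.hom =
      X.left.fromSpecStalk (genericPoint X.left) ≫ X.hom := by
    rw [CurvePlaces.fromSpecStalk_comp_hom X (genericPoint X.left), Category.assoc,
      CurvePlaces.fromSpecStalk_comp_hom C (genericPoint C.left), ← Spec.map_comp]
    congr 1
    apply CommRingCat.hom_ext
    ext x
    change χ (algebraMap K C.left.functionField x) = algebraMap K X.left.functionField x
    exact χ.commutes x
  obtain ⟨U, hξU, f, hf, hfw⟩ := spread_out_of_isGermInjective' X.hom C.hom _ hφ
  refine ⟨U, f, ⟨⟨_, hξU⟩⟩, ⟨?_⟩, hfw⟩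
  have hη : genericPoint C.left ∈ Set.range f := by
    refine ⟨U.fromSpecStalkOfMem _ hξU (IsLocalRing.closedPoint _), ?_⟩
    rw [← Scheme.Hom.comp_apply, ← hf, Scheme.Hom.comp_apply]
    rw [Subsingleton.elim (Spec.map (CommRingCat.ofHom (χ : C.left.functionField →+* X.left.functionField))
      (IsLocalRing.closedPoint _)) (IsLocalRing.closedPoint _)]
    exact Scheme.fromSpecStalk_closedPoint
  rw [DenseRange, dense_iff_closure_eq, ← Set.univ_subset_iff]
  have hcl := closure_mono (Set.singleton_subset_iff.2 hη)
  rwa [(genericPoint_spec C.left).def] at hcl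

end RationalMap

/-! ### The rational function field maps to the function field of the affine line -/

section AffineLine

variable (K : Type u) [Field K]

/-- `k[y] → k[X₀]`, `y ↦ X₀`, is injective (it has the left inverse `X₀ ↦ y`). [folklore] -/
private theorem aeval_X_zero_injective :
    Function.Injective (Polynomial.aeval (MvPolynomial.X (0 : Fin 1)) : Polynomial K →ₐ[K] R₁ K) := by
  have hcomp : (MvPolynomial.aeval (fun _ : Fin 1 => (Polynomial.X : Polynomial K))).comp
      (Polynomial.aeval (MvPolynomial.X (0 : Fin 1)) : Polynomial K →ₐ[K] R₁ K) = AlgHom.id K (Polynomial K) := by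
    apply Polynomial.algHom_ext
    simp
  intro p q h
  have := congrArg (MvPolynomial.aeval (fun _ : Fin 1 => (Polynomial.X : Polynomial K))) h
  rwa [← AlgHom.comp_apply, ← AlgHom.comp_apply, hcomp, AlgHom.id_apply, AlgHom.id_apply] at this

set_option backward.isDefEq.respectTransparency false in
/-- **`K(t) → K(𝔸¹)` over `K`**: the rational function field maps (injectively) to the function field of the
affine line `Spec K[X₀]`, `t ↦ X₀`, compatibly with the `K`-algebra structures (the tree's `RatFn.algebraStalk`
on the generic stalk: `K → K[X₀] → K(𝔸¹)` is the structure map, by Mathlib `Scheme.ΓSpecIso_inv_naturality`).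
[folklore] -/
private theorem nonempty_ratFunc_algHom_functionField_affineLine [IsIntegral (specOver K (R₁ K)).left] :
    Nonempty (RatFunc K →ₐ[K] (specOver K (R₁ K)).left.functionField) := by
  -- `τ : K[X₀] → K(𝔸¹)`, the germ at the generic point, and its compatibility with `K`
  have hτK : (((Scheme.ΓSpecIso (CommRingCat.of (R₁ K))).inv ≫ (specOver K (R₁ K)).left.presheaf.germ ⊤
      (genericPoint (specOver K (R₁ K)).left) trivial).hom).comp (algebraMap K (R₁ K)) =
      algebraMap K ((specOver K (R₁ K)).left.functionField) := by
    change _ = ((Scheme.ΓSpecIso (.of K)).inv ≫ ((specOver K (R₁ K)).left ↘ Spec (.of K)).appTop ≫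
      (specOver K (R₁ K)).left.presheaf.germ ⊤ (genericPoint (specOver K (R₁ K)).left) trivial).hom
    rw [show ((specOver K (R₁ K)).left ↘ Spec (.of K)) = Spec.map (CommRingCat.ofHom (algebraMap K (R₁ K))) from rfl,
      ← Scheme.ΓSpecIso_inv_naturality_assoc]
    rfl
  have hτinj : Function.Injective ((Scheme.ΓSpecIso (CommRingCat.of (R₁ K))).inv ≫
      (specOver K (R₁ K)).left.presheaf.germ ⊤ (genericPoint (specOver K (R₁ K)).left) trivial).hom := by
    rw [CommRingCat.hom_comp]
    exact (germ_injective_of_isIntegral (X := (specOver K (R₁ K)).left) (U := ⊤)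
      (genericPoint (specOver K (R₁ K)).left) trivial).comp
      (Scheme.ΓSpecIso (CommRingCat.of (R₁ K))).commRingCatIsoToRingEquiv.symm.injective
  -- `ψ₀ = aeval X₀ : K[y] → K(𝔸¹)` is `τ ∘ (y ↦ X₀)`, hence injective
  have hψ₀ : (Polynomial.aeval (((Scheme.ΓSpecIso (CommRingCat.of (R₁ K))).inv ≫
      (specOver K (R₁ K)).left.presheaf.germ ⊤ (genericPoint (specOver K (R₁ K)).left) trivial).hom
        (MvPolynomial.X (0 : Fin 1))) : Polynomial K →ₐ[K] (specOver K (R₁ K)).left.functionField).toRingHom =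
      (((Scheme.ΓSpecIso (CommRingCat.of (R₁ K))).inv ≫ (specOver K (R₁ K)).left.presheaf.germ ⊤
        (genericPoint (specOver K (R₁ K)).left) trivial).hom).comp
        (Polynomial.aeval (MvPolynomial.X (0 : Fin 1)) : Polynomial K →ₐ[K] R₁ K).toRingHom := by
    apply Polynomial.ringHom_ext
    · intro a
      rw [AlgHom.toRingHom_eq_coe, AlgHom.coe_toRingHom, Polynomial.aeval_C, RingHom.comp_apply,
        AlgHom.toRingHom_eq_coe, AlgHom.coe_toRingHom, Polynomial.aeval_C, ← RingHom.comp_apply, hτK]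
    · rw [AlgHom.toRingHom_eq_coe, AlgHom.coe_toRingHom, Polynomial.aeval_X, RingHom.comp_apply,
        AlgHom.toRingHom_eq_coe, AlgHom.coe_toRingHom, Polynomial.aeval_X]
  have hinj : Function.Injective (Polynomial.aeval (((Scheme.ΓSpecIso (CommRingCat.of (R₁ K))).inv ≫
      (specOver K (R₁ K)).left.presheaf.germ ⊤ (genericPoint (specOver K (R₁ K)).left) trivial).hom
        (MvPolynomial.X (0 : Fin 1))) : Polynomial K →ₐ[K] (specOver K (R₁ K)).left.functionField) := by
    intro p q h
    have h' := congrArg (fun φ : Polynomial K →+* (specOver K (R₁ K)).left.functionField => φ p) hψ₀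
    have h'' := congrArg (fun φ : Polynomial K →+* (specOver K (R₁ K)).left.functionField => φ q) hψ₀
    simp only [AlgHom.toRingHom_eq_coe, AlgHom.coe_toRingHom, RingHom.comp_apply] at h' h''
    rw [h', h''] at h
    exact aeval_X_zero_injective K (hτinj h)
  exact ⟨RatFunc.liftAlgHom _ (nonZeroDivisors_le_comap_nonZeroDivisors_of_injective _ hinj)⟩

end AffineLine

/-! ### Schemes dominated by an open of the affine line have only constant maps to abelian varieties -/

section Constant

variable {K : Type u} [Field K] (C : SchemeOver K) [IsIntegral C.left]

/-- **A `K`-scheme dominated by an open of the affine line admits only constant morphisms to abelian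
varieties**: if `f : U → C` is a dominant `K`-morphism from a non-empty open `U ⊆ 𝔸¹_K` and `C` is reduced
(here: integral), then every `K`-morphism `ψ : C → A` to an abelian variety is `ψ = (C → Spec K) ≫ P₀` for a
section `P₀ : Spec K → A`.  Proof: `U → C → A` extends to `𝔸¹ → A` (Milne, *Abelian Varieties*, Thm. 3.1,
★ `AbelianVariety.exists_extension_specMap`), which is constant (Cor. 3.8, ★ `AbelianVariety.specMap_affineLine_const`);
so `ψ` agrees with a constant map after the dominant `f`, and `A` is separated (Mathlib
`ext_of_isDominant_of_isSeparated`). [cite: Milne1986AbelianVarieties, §3 Thm. 3.1 and Cor. 3.8 (p. 107)] -/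
theorem AbelianVariety.exists_eq_hom_comp_of_isDominant {U : (Spec (CommRingCat.of (R₁ K))).Opens}
    [Nonempty (U : Scheme.{u})] (f : (U : Scheme.{u}) ⟶ C.left) [IsDominant f]
    (hfw : f ≫ C.hom = U.ι ≫ Spec.map (CommRingCat.ofHom (algebraMap K (R₁ K)))) (A : AbelianVariety K)
    (ψ : C ⟶ A.X) :
    ∃ P₀ : Spec (.of K) ⟶ A.X.left, P₀ ≫ A.X.hom = 𝟙 _ ∧ ψ.left = C.hom ≫ P₀ := by
  haveI := smooth_specOver_mvPolynomial (k := K) 1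
  haveI := geometricallyIntegral_specOver_mvPolynomial (k := K) 1
  obtain ⟨H, hHw, hH⟩ := A.exists_extension_specMap U.ι (f ≫ ψ.left) (by rw [Category.assoc, Over.w ψ]; exact hfw)
  obtain ⟨P₀, hP₀⟩ := A.specMap_affineLine_const H hHw
  -- a `K`-point of the line shows `P₀` is a section
  have he₀ : Spec.map (CommRingCat.ofHom (MvPolynomial.aeval (0 : Fin 1 → K) : R₁ K →ₐ[K] K).toRingHom) ≫
      Spec.map (CommRingCat.ofHom (algebraMap K (R₁ K))) = 𝟙 _ := by
    rw [specMap_ofHom_comp_specMap_ofHom, AlgHom.toRingHom_eq_coe, AlgHom.comp_algebraMap, Algebra.algebraMap_self,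
      CommRingCat.ofHom_id, Spec.map_id]
  have hP₀' : P₀ = Spec.map (CommRingCat.ofHom (MvPolynomial.aeval (0 : Fin 1 → K) : R₁ K →ₐ[K] K).toRingHom) ≫ H := by
    rw [hP₀, ← Category.assoc, he₀, Category.id_comp]
  refine ⟨P₀, ?_, ?_⟩
  · rw [hP₀', Category.assoc, hHw, he₀]
  refine ext_of_isDominant_of_isSeparated A.X.hom ?_ f ?_
  · rw [Over.w ψ, Category.assoc, hP₀', Category.assoc, hHw, he₀, Category.comp_id]
  · rw [← hH, ← Category.assoc f C.hom, hfw, Category.assoc, ← hP₀]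

end Constant

/-! ### Curves (schemes) whose function field embeds in `K(t)` -/

section Unirational

variable {K : Type u} [Field K] (C : SchemeOver K) [IsIntegral C.left] [LocallyOfFiniteType C.hom]

/-- **Abelian varieties contain no unirational curves ∕ varieties**: if the function field of the integral
`K`-scheme `C` (locally of finite type) embeds over `K` into the rational function field `K(t)`, every
`K`-morphism `ψ : C → A` to an abelian variety is CONSTANT, `ψ = (C → Spec K) ≫ P₀` for a section `P₀`
(Milne, *Abelian Varieties*, §3 Cor. 3.8 in birational form; see the module docstring for the proof).
[cite: Milne1986AbelianVarieties, §3 Thm. 3.1 and Cor. 3.8 (p. 107)] -/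
theorem AbelianVariety.exists_eq_hom_comp_of_functionField_toRatFunc
    (χ₀ : C.left.functionField →ₐ[K] RatFunc K) (A : AbelianVariety K) (ψ : C ⟶ A.X) :
    ∃ P₀ : Spec (.of K) ⟶ A.X.left, P₀ ≫ A.X.hom = 𝟙 _ ∧ ψ.left = C.hom ≫ P₀ := by
  haveI : IsIntegral (specOver K (R₁ K)).left := inferInstanceAs (IsIntegral (Spec (CommRingCat.of (R₁ K))))
  obtain ⟨χ₁⟩ := nonempty_ratFunc_algHom_functionField_affineLine K
  obtain ⟨U, f, hU, hf, hfw⟩ := exists_isDominant_of_functionField_algHom C (specOver K (R₁ K)) (χ₁.comp χ₀)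
  exact @AbelianVariety.exists_eq_hom_comp_of_isDominant K _ C _ U hU f hf hfw A ψ

/-- The constant-map form in the tree's `k`-points vocabulary: `ψ = toSpecOver C ≫ a` for a `K`-point
`a ∈ A(K)`. [cite: Milne1986AbelianVarieties, §3 Cor. 3.8 (p. 107)] -/
theorem AbelianVariety.exists_eq_toSpecOver_comp_of_functionField_toRatFunc
    (χ₀ : C.left.functionField →ₐ[K] RatFunc K) (A : AbelianVariety K) (ψ : C ⟶ A.X) :
    ∃ a : AlgPoints A.X K, ψ = toSpecOver C ≫ a := by
  obtain ⟨P₀, hP₀, hψ⟩ := AbelianVariety.exists_eq_hom_comp_of_functionField_toRatFunc C χ₀ A ψ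
  refine ⟨AlgPoints.mk P₀ (by rw [hP₀, Algebra.algebraMap_self, CommRingCat.ofHom_id, Spec.map_id]), ?_⟩
  apply Over.OverMorphism.ext
  rw [Over.comp_left]
  exact hψ

/-- Pointwise form: such a `K`-morphism is constant on the underlying spaces.
[cite: Milne1986AbelianVarieties, §3 Cor. 3.8 (p. 107)] -/
theorem AbelianVariety.hom_base_eq_of_functionField_toRatFunc (χ₀ : C.left.functionField →ₐ[K] RatFunc K)
    (A : AbelianVariety K) (ψ : C ⟶ A.X) (a b : ↥C.left) : ψ.left a = ψ.left b := by
  obtain ⟨P₀, -, hψ⟩ := AbelianVariety.exists_eq_hom_comp_of_functionField_toRatFunc C χ₀ A ψ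
  rw [hψ, Scheme.Hom.comp_apply, Scheme.Hom.comp_apply, Subsingleton.elim (C.hom a) (C.hom b)]

/-- Pointed form: such a `K`-morphism sending some `K`-point to the origin is the trivial (unit) morphism.
[cite: Milne1986AbelianVarieties, §3 Cor. 3.8 (p. 107)] -/
theorem AbelianVariety.eq_one_of_point_comp_eq_one_of_functionField_toRatFunc
    (χ₀ : C.left.functionField →ₐ[K] RatFunc K) (A : AbelianVariety K) (ψ : C ⟶ A.X) (P : AlgPoints C K)
    (hP : P ≫ ψ = 1) : ψ = 1 := by
  obtain ⟨a, ha⟩ := AbelianVariety.exists_eq_toSpecOver_comp_of_functionField_toRatFunc C χ₀ A ψ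
  have ha1 : a = 1 := by
    rw [ha, ← Category.assoc, Jacobian.point_comp_toSpecOver, Category.id_comp] at hP
    exact hP
  rw [ha, ha1, MonObj.comp_one]

end Unirational

section UnirationalProper

variable {K : Type u} [Field K] (C : SchemeOver K) [IsIntegral C.left] [IsProper C.hom]

/-- **Such a curve ∕ variety, if proper with a `K`-point, has trivial Albanese–Jacobian**: the trivial abelian
variety `Spec K` (★ `AbelianVariety.trivial`) with the constant map satisfies Milne's pointed universal property
(*Jacobian Varieties*, Prop. 6.1 — every pointed map `C → A` is trivial), hence is a `Jacobian C` (Prop. 6.4,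
★ `Jacobian.ofPointed`). [cite: Milne1986JacobianVarieties, §6 Prop. 6.1 and Prop. 6.4] -/
theorem Jacobian.nonempty_of_functionField_toRatFunc [GeometricallyIntegral C.hom]
    (χ₀ : C.left.functionField →ₐ[K] RatFunc K) (P : AlgPoints C K) : Nonempty (Jacobian C) := by
  refine ⟨Jacobian.ofPointed P (AbelianVariety.trivial K) (toUnit C) (toUnit_unique _ _) (fun _ _ => 0)
    (fun g hg' => ?_) (fun g hg' φ hφ' => ?_)⟩
  · rw [AbelianVariety.eq_one_of_point_comp_eq_one_of_functionField_toRatFunc C χ₀ _ g P hg',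
      AbelianVariety.hom_zero, Grp.Hom.hom_one, Mon.Hom.hom_one, MonObj.comp_one]
  · refine (generates_toUnit (X := C)).hom_ext ?_
    rw [AbelianVariety.hom_zero, Grp.Hom.hom_one, Mon.Hom.hom_one, MonObj.comp_one]
    rw [AbelianVariety.eq_one_of_point_comp_eq_one_of_functionField_toRatFunc C χ₀ _ g P hg'] at hφ'
    exact hφ'

/-- **… and every Jacobian of it is `0`**: the Abel–Jacobi map `f^P : C → J` is pointed, hence trivial, and
its image generates `J` (★ `Jacobian.hom_ext_abelJacobi`), so `𝟙_J = 0`, forcing `dim J = 0`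
(★ `not_isIsogeny_zero_of_dim_pos`). [cite: Milne1986JacobianVarieties, Prop. 2.1 and §6 Prop. 6.1] -/
theorem Jacobian.dim_eq_zero_of_functionField_toRatFunc (χ₀ : C.left.functionField →ₐ[K] RatFunc K)
    (P : AlgPoints C K) (𝒥 : Jacobian C) : 𝒥.J.dim = 0 := by
  have h1 : 𝒥.abelJacobi P = 1 :=
    AbelianVariety.eq_one_of_point_comp_eq_one_of_functionField_toRatFunc C χ₀ _ _ P (𝒥.point_comp_abelJacobi P)
  have hid : (𝟙 𝒥.J : 𝒥.J ⟶ 𝒥.J) = 0 := by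
    refine 𝒥.hom_ext_abelJacobi P _ _ ?_
    rw [h1, MonObj.one_comp, MonObj.one_comp]
  by_contra hne
  exact AbelianVariety.not_isIsogeny_zero_of_dim_pos (Nat.pos_of_ne_zero hne) (hid ▸ AbelianVariety.isIsogeny_id 𝒥.J)

end UnirationalProper

end Literature.AlgebraicGeometry.Motives

end
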